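import Summits.BirchSwinnertonDyer.Rank1Residual.GaloisImage.SakamotoN11InstanceLevelOneInputs
import Summits.BirchSwinnertonDyer.Rank1Residual.GaloisImage.PropagatedConditionCard
import Literature.NumberTheory.GaloisCohomology.Sakamoto2024KolyvaginFittingIdeal
import HarnessLib

/-!
# Sakamoto 2024 Thm. 4.4 (1)–(2) at `m = 1` DIRECTLY on `(E[3], 𝓕̄_can)` (`T = T̄ = E[3]`,
# residual pair = identities) from surj(3) alone — the natural currency of the EXOTIC unit case
# (cell `b2b-bsdres`, team n1011, rows T-a3-F1 / T-a5x; seat p13)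

HONEST FRAMING (cell `b2b-bsdres`, run/shared/lean/b2b/bsd-rank1-residual/, verbatim in every
file): the goal of the cell is to DELETE the COMBINATION-SHAPED residual classes of the
Birch–Swinnerton-Dyer formula for ALL analytic-rank `≤ 1` elliptic curves over `ℚ` — "full BSD
formula for every rank `≤ 1` curve in class `C`" assembled STRICTLY from published theorems — so
that the rank-`≤ 1` remainder becomes exactly the CONSTRUCTION-SHAPED classes, which are TYPED
(missing-input `Prop`s), NOT attempted. This is not "finishing BSD". Team n1011 (N10/N11, the
additive block `X4 ∧ p = 3`): research route; no claim beyond the stated classes; the label X4 and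
the mark of RESIDUAL-MAP §I N11 are UNCHANGED by this file; nothing is booked. Theorems and ONE
global instance (the `𝔽₃`-module structure of `E[3]`, unique); no named fact is minted. The two end
theorems are CONDITIONAL on the tree's named facts
`Sakamoto2024.kolyvaginSystems_freeRankOne_zmod_three_pow` (Thm. 4.4 (1); p254540) resp.
`Sakamoto2024.kolyvaginSystems_idealOfBasis_eq_fittingIdeal_zmod_three_pow` (Thm. 4.4 (2); R1-22),
and on Tate's local Euler–Poincaré characteristic (`hEP`), all explicit.

## What and why

The level-one instances so far (p260356 / p260877 / `SakamotoN11InstanceFitting`) live in the fact's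
`k = 0` spelling `T = E[3^0·3]`, `𝓕 = propagatedSelmerStructure W 3 0`, whose objects are only
propositionally equal to `E[3]`, `𝓕̄_can`.  For the EXOTIC unit case one wants the statements ON
`E[3]` ITSELF — where the `3`-Selmer group `Sel₃(E/ℚ) = H¹_𝓚(ℚ, E[3])`, the core rank
`χ(𝓕̄_can) = 1` and p11's core-rank-zero reading all live.  At `m = 1` Sakamoto's pair `(T, T̄)` may
be taken to be `(E[3], E[3])` with BOTH maps of the residual pair the IDENTITY: `red = id` is onto,
`ker red = 0 = 3·E[3]`, `incl ∘ red = 3⁰ = id` — a legitimate instance of the facts' universally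
quantified residual pair.  Then `𝓕.induced id = 𝓕` and "cartesian" is automatic, so the facts apply
to `𝓕 := 𝓕̄_can = propagatedSelmerStructureOne W 3` directly:

* `IdPair.map_id_one_apply`, `IdPair.restrictField_id`, `IdPair.localMap_id_apply`,
  `IdPair.induced_id`, `IdPair.isCartesian_id` — the identity residual pair (generic `K`, `M`).
* `instModuleZModThreeGeomTorsionThree` — the `𝔽₃`-module `E[3]` (global, as p255331's level
  instances); `three_nsmul_geomTorsion_three`, `id_eq_zero_iff_exists`, `id_id_eq_pow_smul` — the
  residual-pair axioms for `(id, id)` at `m = 1`.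
* `propagatedSelmerStructureOne_three_isUnramifiedOutside` — `𝓕̄_can` on `E[3]` is unramified outside
  any `S ⊇ ∞ ∪ {3} ∪ {bad}` (p06's `𝓕̄_can,ℓ = 𝓚_ℓ` off `3` + p05's bounded exponent + x11b's Kummer
  unramifiedness); `not_mem_and_isUnramifiedAt_three_of_not_mem` — the companion `hS'`.
* **`kolyvaginSystems_freeRankOne_propagatedSelmerStructureOne_of_surj`** — Thm. 4.4 (1) at `m = 1`
  on `(E[3], 𝓕̄_can)` from surj(3) ALONE: `KS₁(E[3], 𝓕̄_can, 𝒫(τ)) ≅ 𝔽₃`, and `κ ↦ κ_d` bijective onto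
  `H¹_{𝓕̄_can(d)}(ℚ, E[3])` whenever `λ*(d) = 0`; every dischargeable hypothesis discharged ((H.1),
  (H.3) via p04's `hH3_self_of_hasSurjectiveModNGaloisRep`, Weil, cartesian, `hS'`/`hunr`, core rank
  via p13 + p05 + Silverman X.4.2 (b) + p13's self-duality count).
* **`kolyvaginSystems_idealOfBasis_propagatedSelmerStructureOne_of_surj`** — Thm. 4.4 (2) likewise,
  with the full-level Poitou–Tate family `inv' : LocalInvariants ℚ 3` (at `m = 1` it may be `inv`).

Binders of record (both theorems; nothing hidden): the fact, `[Finite E[3]]`, surj(3), the `τ`-datum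
(`τ ∈ Γ_{ℚ(μ₃)}`, `E[3]/(τ−1) ≃ ℤ/3` — exists, p260356), the Poitou–Tate family `inv` ×4,
`hEP`, an admissible `S`, the Kolyvagin datum on `E[3]` (+ `inv'` ×4, `κ`, `d` for (2)).
What is NOT here: the unit-case consequences (next file `KolyvaginLevelOneUnitCase.lean`); any
discharge of the facts, the PT family, `hEP` or (Lp); any class theorem.

References: R. Sakamoto, JTNB 36 (2024) §2, §3.1, Thm. 4.4 [Sakamoto2024]; B. Mazur, K. Rubin,
Mem. AMS 799 (2004) §3.5, Cor. 4.5.2 [MazurRubin2004]; J.-P. Serre, *Galois Cohomology* I §2;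
J. H. Silverman, *AEC* III.8.1, X.4.2 [SilvermanAEC2009]; J. S. Milne, *ADT* I Thm. 2.8 [MilneADT2006].
-/

noncomputable section

open scoped Classical NumberField ContRepresentation
open Field NumberField IsDedekindDomain
open WeierstrassCurve Literature.NumberTheory.EllipticCurves Literature.NumberTheory.GaloisRepresentations
  Literature.NumberTheory.GaloisRepresentations.DiscreteGaloisModule Literature.NumberTheory.GaloisCohomology

universe u

namespace Summit.BirchSwinnertonDyer.Rank1Residual.GaloisImage

/-! ### The identity residual pair: `localMap id = id`, `𝓕.induced id = 𝓕`, cartesian for free -/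

namespace IdPair

variable {K : Type u} [Field K] [NumberField K] {M : Type u} [AddCommGroup M] [TopologicalSpace M]
  [DiscreteTopology M] {ρ : DiscreteGaloisModule K M}

/-- `H¹(id) = id`: the map on `H¹(K, M)` induced by the identity intertwining map is the identity
(`[φ] ↦ [id ∘ φ ∘ id]`). [folklore] -/
theorem map_id_one_apply {F : Type u} [Field F] {N : Type u} [AddCommGroup N] [TopologicalSpace N]
    [DiscreteTopology N] (σ : DiscreteGaloisModule F N) (c : galoisCohomology σ 1) :
    galoisCohomology.map (ContIntertwiningMap.id : σ.toContRepresentation →ⁱL σ.toContRepresentation)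
      1 c = c := by
  obtain ⟨φ, rfl⟩ := oneCocycleClass_surjective σ.toTopRep c
  rw [galoisCohomology.map_one_oneCocycleClass]
  rfl

omit [NumberField K] in
/-- Restricting the identity intertwining map to `Γ_E` gives the identity. [folklore] -/
theorem restrictField_id (E : Type u) [Field E] [Algebra K E] :
    (ContIntertwiningMap.id : ρ.toContRepresentation →ⁱL ρ.toContRepresentation).restrictField E =
      ContIntertwiningMap.id := rfl

/-- `H¹(id) = id` at every place: the local map induced by the identity intertwining map is the
identity on `H¹(K_v, M)`. [folklore] -/
theorem localMap_id_apply (v : Place K) (c : galoisCohomology (ρ.toLocal v) 1) :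
    localMap (ContIntertwiningMap.id : ρ.toContRepresentation →ⁱL ρ.toContRepresentation) v c
      = c := by
  unfold localMap
  rw [restrictField_id]
  exact map_id_one_apply (ρ.toLocal v) c

/-- `𝓕.induced id = 𝓕`. [folklore] -/
theorem induced_id (𝓕 : SelmerStructure ρ) :
    𝓕.induced (ContIntertwiningMap.id : ρ.toContRepresentation →ⁱL ρ.toContRepresentation) = 𝓕 := by
  funext v
  refine AddSubgroup.ext fun x => ⟨fun hx => ?_, fun hx => ?_⟩
  · obtain ⟨y, hy, rfl⟩ := (𝓕.mem_induced_iff _ v x).mp hx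
    rwa [localMap_id_apply]
  · exact (𝓕.mem_induced_iff _ v x).mpr ⟨x, hx, localMap_id_apply v x⟩

/-- Every Selmer structure is cartesian for the identity pair `(red, incl) = (id, id)`. [folklore] -/
theorem isCartesian_id (𝓕 : SelmerStructure ρ) (S : Finset (Place K)) :
    𝓕.IsCartesian (ContIntertwiningMap.id : ρ.toContRepresentation →ⁱL ρ.toContRepresentation)
      (ContIntertwiningMap.id : ρ.toContRepresentation →ⁱL ρ.toContRepresentation) S := by
  intro v _ x hx
  rw [localMap_id_apply] at hx
  rwa [induced_id]

end IdPair

/-! ### `E[3]` as the fact's `T` at `m = 1` -/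

variable (W : WeierstrassCurve ℚ) [W.IsElliptic]

omit [W.IsElliptic] in
/-- The `𝔽₃ = ℤ/3`-module structure of `E[3]` = Mathlib's `AddSubgroup.torsionBy.zmodModule` (the
unique one on a group killed by `3`; elsewhere in the tree a `letI`), registered GLOBALLY here — as
the level instances of `SakamotoN11Instance` — because the STATEMENTS below mention
`D.HasCanonicalComparison 3 η`, whose instance arguments `[Module (ZMod 3) E[3]]` (`Free`, `Finite`
follow: `𝔽₃` is a field, `E[3]` is finite) must be found by every consumer identically. [folklore] -/
instance instModuleZModThreeGeomTorsionThree : Module (ZMod 3) (geomTorsion W ((3 : ℕ) : ℤ)) :=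
  AddSubgroup.torsionBy.zmodModule

omit [W.IsElliptic] in
/-- `3 • x = 0` on `E[3]` (as an `ℕ`-scalar). [folklore] -/
theorem three_nsmul_geomTorsion_three (x : geomTorsion W ((3 : ℕ) : ℤ)) : (3 : ℕ) • x = 0 :=
  AddSubgroup.torsionBy.nsmul x

omit [W.IsElliptic] in
/-- The identity is Sakamoto's reduction at `m = 1`: `x = 0 ↔ ∃ y ∈ E[3], x = 3 • y`. [folklore] -/
theorem id_eq_zero_iff_exists (x : geomTorsion W ((3 : ℕ) : ℤ)) :
    (ContIntertwiningMap.id : (W.torsionGaloisModule ((3 : ℕ) : ℤ)).toContRepresentation →ⁱL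
      (W.torsionGaloisModule ((3 : ℕ) : ℤ)).toContRepresentation) x = 0 ↔
      ∃ y : geomTorsion W ((3 : ℕ) : ℤ), x = (3 : ℤ) • y := by
  change x = 0 ↔ _
  constructor
  · rintro rfl
    exact ⟨0, (smul_zero _).symm⟩
  · rintro ⟨y, rfl⟩
    have h := three_nsmul_geomTorsion_three W y
    rwa [← natCast_zsmul] at h

omit [W.IsElliptic] in
/-- `incl (red x) = 3^{1-1} • x` for the identity pair. [folklore] -/
theorem id_id_eq_pow_smul (x : geomTorsion W ((3 : ℕ) : ℤ)) :
    (ContIntertwiningMap.id : (W.torsionGaloisModule ((3 : ℕ) : ℤ)).toContRepresentation →ⁱL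
      (W.torsionGaloisModule ((3 : ℕ) : ℤ)).toContRepresentation)
      ((ContIntertwiningMap.id : (W.torsionGaloisModule ((3 : ℕ) : ℤ)).toContRepresentation →ⁱL
        (W.torsionGaloisModule ((3 : ℕ) : ℤ)).toContRepresentation) x) = ((3 : ℤ) ^ (1 - 1)) • x := by
  change x = _
  rw [Nat.sub_self, pow_zero, one_smul]

/-! ### `𝓕̄_can = propagatedSelmerStructureOne W 3` is unramified outside an admissible `S` -/

/-- For `S ⊇ ∞ ∪ {3} ∪ {bad}`, the residual canonical structure `𝓕̄_can` on `E[3]` is unramified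
outside `S`: off `3` it IS the Kummer condition (n1011-p06
`propagatedSelmerStructureOne_inr_eq_kummerSelmerStructure`, with n1011-p05's bounded exponent
`bounded_pPrimaryTorsion_localGaloisModule_rat`), and the Kummer structure is unramified at good
places prime to `3` (x11b `KummerDuality.kummerSelmerStructure_isUnramifiedOutside`). [folklore] -/
theorem propagatedSelmerStructureOne_three_isUnramifiedOutside (S : Finset (Place ℚ))
    (hS : ∀ w : InfinitePlace ℚ, (Sum.inl w : Place ℚ) ∈ S)
    (h3S : ∀ v : HeightOneSpectrum (𝓞 ℚ), ((3 : ℕ) : 𝓞 ℚ) ∈ v.asIdeal → (Sum.inr v : Place ℚ) ∈ S)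
    (hbadS : ∀ v : HeightOneSpectrum (𝓞 ℚ), ¬ W.HasGoodReductionAt v → (Sum.inr v : Place ℚ) ∈ S) :
    (propagatedSelmerStructureOne W 3).IsUnramifiedOutside S := by
  haveI : Fact (Nat.Prime 3) := ⟨Nat.prime_three⟩
  have hK := X11b.KummerDuality.kummerSelmerStructure_isUnramifiedOutside W 3 1 S hS h3S hbadS
  rw [pow_one] at hK
  refine ⟨hS, fun v hv => ?_⟩
  have h3v : ((3 : ℕ) : 𝓞 ℚ) ∉ v.asIdeal := fun h => hv (h3S v h)
  rw [propagatedSelmerStructureOne_inr_eq_kummerSelmerStructure W 3 v h3v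
    (bounded_pPrimaryTorsion_localGaloisModule_rat W 3 h3v)]
  exact hK.2 v hv

/-- The companion `hS'` for `E[3]`: off `S`, prime to `3` and unramified (Silverman VII.4.1). [folklore] -/
theorem not_mem_and_isUnramifiedAt_three_of_not_mem (S : Finset (Place ℚ))
    (h3S : ∀ v : HeightOneSpectrum (𝓞 ℚ), ((3 : ℕ) : 𝓞 ℚ) ∈ v.asIdeal → (Sum.inr v : Place ℚ) ∈ S)
    (hbadS : ∀ v : HeightOneSpectrum (𝓞 ℚ), ¬ W.HasGoodReductionAt v → (Sum.inr v : Place ℚ) ∈ S)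
    {v : HeightOneSpectrum (𝓞 ℚ)} (hv : (Sum.inr v : Place ℚ) ∉ S) :
    ((3 : ℕ) : 𝓞 ℚ) ∉ v.asIdeal ∧ GaloisRep.IsUnramifiedAt v (W.torsionGaloisModule ((3 : ℕ) : ℤ)) := by
  have h3v : ((3 : ℕ) : 𝓞 ℚ) ∉ v.asIdeal := fun h => hv (h3S v h)
  have hgood : W.HasGoodReductionAt v := by by_contra h; exact hv (hbadS v h)
  exact ⟨h3v, X11b.AcSelmer.isUnramifiedAt_torsionGaloisModule W hgood (by rwa [Int.cast_natCast])⟩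

/-! ### Thm. 4.4 (1) and (2) at `m = 1` on `(E[3], 𝓕̄_can)` from surj(3) alone -/

/-- **Sakamoto's Thm. 4.4 (1) at `m = 1` directly on `(E[3], 𝓕̄_can)`, from surj(3) ALONE.**
`T = T̄ = E[3]` (`W.torsionGaloisModule 3`), residual pair = the identities (legitimate at `m = 1`:
`red` onto, `ker red = 0 = 3·E[3]`, `incl ∘ red = 3⁰`), `𝓕 = 𝓕̄_can = propagatedSelmerStructureOne W 3`
(Mazur–Rubin's structure propagated from `T₃E`, read on `E[3]`).  DISCHARGED: (H.1) from surj(3);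
(H.3) at `m = 1` by n1011-p04's `hH3_self_of_hasSurjectiveModNGaloisRep` (no tower); (H.SD) and the
residual coisotropy by the Weil choice of `θ` (n1011-p18); cartesian (trivial for the identity
pair); `hS'`/`hunr` for `S ⊇ ∞ ∪ {3} ∪ {bad}`; the CORE RANK `χ(𝓕̄_can) = 1` by p13's
`hasCoreRank_one_propagatedSelmerStructureOne` with `hbd` (p05), `hKfin` (Silverman X.4.2 (b)),
`hKSD` (p13) and (Lp) `hLpIm` (n1011-p04 T-Lp `natCard_propagatedSelmerStructureOne_three`, from `hEP`)
discharged; the `ℤ/3`-module structure inside the proof (`𝔽₃` a field).  CONCLUSION: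
`KS₁(E[3], 𝓕̄_can, 𝒫(τ))` is free of rank one over `𝔽₃`, and `κ ↦ κ_d` is a bijection onto
`H¹_{𝓕̄_can(d)}(ℚ, E[3])` at every level `d` with `λ*(d) = 0` (`λ*` for the residual family `inv`).
Binders (nothing hidden): the fact `hS24`, `[Finite E[3]]`, surj(3), the `τ`-datum (`τ ∈ Γ_{ℚ(μ₃)}`,
`E[3]/(τ−1) ≃ ℤ/3` — exists by p260356 `exists_rootsOfUnityFixer_cokerSubOne_equiv_zmod_three_of_surj`),
the Poitou–Tate family `inv` ×4, `hEP` (which now ALSO discharges the located gap (Lp) — n1011-p04's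
T-Lp `natCard_propagatedSelmerStructureOne_three`, p263840), an admissible `S`, the
Kolyvagin datum on `E[3]` (`D`, `η`, `hP`, `hT`, `hD`).  No tower: every surj(3) row incl. EXOTIC.
CONDITIONAL on `hS24`; nothing booked; no mark changed.
[cite: Sakamoto2024, §2 (H.1)–(H.3) (p. 921), Def. 3.5–3.8 (pp. 923–924), Thm. 4.4 (1) (p. 926)] -/
theorem kolyvaginSystems_freeRankOne_propagatedSelmerStructureOne_of_surj
    (hS24 : Sakamoto2024.kolyvaginSystems_freeRankOne_zmod_three_pow)
    [Finite (geomTorsion W ((3 : ℕ) : ℤ))]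
    (h3 : W.HasSurjectiveModNGaloisRep ((3 : ℕ) : ℤ))
    (τ : absoluteGaloisGroup ℚ) (hτμ : τ ∈ rootsOfUnityFixer ℚ 3)
    (hτq : Nonempty (cokerSubOne (W.torsionGaloisModule ((3 : ℕ) : ℤ)) τ ≃+ ZMod 3))
    (inv : LocalInvariants ℚ 3) (hperf : inv.IsPerfect) (hsum : inv.SumLocalTermEqZero)
    (hunro : inv.UnramifiedOrthogonal) (hcompl : inv.SelmerComplement)
    (hEP : ∀ v : HeightOneSpectrum (𝓞 ℚ), localEulerPoincareCharacteristic (v.adicCompletion ℚ))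
    (S : Finset (Place ℚ)) (hS : ∀ w : InfinitePlace ℚ, (Sum.inl w : Place ℚ) ∈ S)
    (h3S : ∀ v : HeightOneSpectrum (𝓞 ℚ), ((3 : ℕ) : 𝓞 ℚ) ∈ v.asIdeal → (Sum.inr v : Place ℚ) ∈ S)
    (hbadS : ∀ v : HeightOneSpectrum (𝓞 ℚ), ¬ W.HasGoodReductionAt v → (Sum.inr v : Place ℚ) ∈ S)
    (D : KolyvaginDatum (W.torsionGaloisModule ((3 : ℕ) : ℤ)))
    (η : (q : HeightOneSpectrum (𝓞 ℚ)) → (ZMod (Ideal.absNorm q.asIdeal))ˣ)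
    (hP : D.primes = frobeniusClassPrimes (W.torsionGaloisModule ((3 : ℕ) : ℤ))
      {v | (Sum.inr v : Place ℚ) ∈ S} τ 3)
    (hT : D.transverse = cyclotomicTransverse (W.torsionGaloisModule ((3 : ℕ) : ℤ)))
    (hD : D.HasCanonicalComparison 3 η) :
    KolyvaginSystem.IsFreeRankOneZMod (D.kolyvaginSystems (propagatedSelmerStructureOne W 3)) 3 ∧
      ∀ (d : Finset (HeightOneSpectrum (𝓞 ℚ))) (hd : D.IsLevel d),
        LocalInvariants.lambdaStar inv (D.atLevel (propagatedSelmerStructureOne W 3) d) 3 = 0 →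
        Function.Bijective fun κ : D.kolyvaginSystems (propagatedSelmerStructureOne W 3) =>
          (⟨κ.1 d, ((KolyvaginDatum.mem_kolyvaginSystems_iff D _ κ.1).mp κ.2).mem_selmerGroup
              d hd⟩ : (D.atLevel (propagatedSelmerStructureOne W 3) d).selmerGroup) := by
  haveI : Fact (Nat.Prime 3) := ⟨Nat.prime_three⟩
  haveI : NeZero ((3 : ℕ) : ℚ) := ⟨by norm_num⟩
  -- the `ℤ/3^1`-module `E[3]` (any structure is admissible: the fact quantifies over it)
  haveI hF : Fact (Nat.Prime (3 ^ 1)) := ⟨by norm_num⟩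
  letI : Module (ZMod (3 ^ 1)) (geomTorsion W ((3 : ℕ) : ℤ)) :=
    (inferInstance : Module (ZMod 3) (geomTorsion W ((3 : ℕ) : ℤ)))
  haveI : Module.Finite (ZMod (3 ^ 1)) (geomTorsion W ((3 : ℕ) : ℤ)) := Module.Finite.of_finite
  -- the Weil datum, the `3`-descent finiteness / self-duality count, the core rank
  obtain ⟨e, hμ, hadd₁, hadd₂, halt, hnondeg, hgal⟩ :=
    exists_weilPairing_holds W 3 (by norm_num) (by norm_num)
  let T : Finset (HeightOneSpectrum (𝓞 ℚ)) := S.preimage Sum.inr Sum.inr_injective.injOn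
  have h3T : ∀ v : HeightOneSpectrum (𝓞 ℚ), ((3 : ℕ) : 𝓞 ℚ) ∈ v.asIdeal → v ∈ T :=
    fun v hv => Finset.mem_preimage.mpr (h3S v hv)
  have hbadT : ∀ v : HeightOneSpectrum (𝓞 ℚ), ¬ W.HasGoodReductionAt v → v ∈ T :=
    fun v hv => Finset.mem_preimage.mpr (hbadS v hv)
  have hKfin : Finite (W.kummerSelmerStructure ((3 : ℕ) : ℤ)).selmerGroup := by
    rw [← selmerGroup_eq_selmerGroup_kummerSelmerStructure]
    exact W.finite_selmerGroup_holds (by norm_num)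
  haveI := hKfin
  have hKSD := natCard_selmerGroup_kummer_eq_dual W 3 e hμ hadd₁ hadd₂ hgal halt hnondeg
    Nat.prime_three.isPrimePow (by decide) inv (fun v => (hperf v).1.injective) hEP
  have hCR : LocalInvariants.HasCoreRank inv (propagatedSelmerStructureOne W 3) 3 1 :=
    hasCoreRank_one_propagatedSelmerStructureOne W inv hperf hsum hcompl T h3T hbadT
      (fun v hv => bounded_pPrimaryTorsion_localGaloisModule_rat W 3 hv) hKfin hKSD
      (fun v hv => natCard_propagatedSelmerStructureOne_three W v (hEP v) hv)
  have hco := isResiduallyCoisotropic_propagatedSelmerStructureOne_three W e hμ hadd₁ hadd₂ hgal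
    halt hnondeg inv hperf S (fun v _ => hEP v)
  -- the fact at `m = 1`, `T = T̄ = E[3]`, identity residual pair
  have h := hS24 (geomTorsion W ((3 : ℕ) : ℤ)) (geomTorsion W ((3 : ℕ) : ℤ)) 1
    (W.torsionGaloisModule _) (W.torsionGaloisModule _) ContIntertwiningMap.id ContIntertwiningMap.id
    τ (weilDualIntertwining W 3 e hμ hadd₁ hadd₂ hgal) inv S (propagatedSelmerStructureOne W 3) D η
    (fun x => ⟨x, rfl⟩) (id_eq_zero_iff_exists W) (id_id_eq_pow_smul W)
    (residual_irreducible_of_surj W 3 h3) (by simpa using hτμ) (by simpa using hτq)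
    (fun f hf => hH3_self_of_hasSurjectiveModNGaloisRep W 3 (by decide) h3 f
      (fun u hu hμu => hf u hu (by simpa using hμu)))
    (X11b.LocBridge.weilDualHom_bijective W 3 e hμ hadd₁ hadd₂ hnondeg)
    hperf hsum hunro hcompl hS (fun v hv => not_mem_and_isUnramifiedAt_three_of_not_mem W S h3S hbadS hv)
    (propagatedSelmerStructureOne_three_isUnramifiedOutside W S hS h3S hbadS)
    (IdPair.isCartesian_id _ S) (by rw [IdPair.induced_id]; exact hCR)
    (by rw [IdPair.induced_id]; exact hco) (by simpa using hP) hT (by simpa using hD)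
  refine ⟨by simpa using h.1, fun d hd hlam => h.2 d hd ?_⟩
  rwa [IdPair.induced_id]


/-- **Sakamoto's Thm. 4.4 (2) at `m = 1` directly on `(E[3], 𝓕̄_can)`, from surj(3) ALONE** (n1011-p11's
unfolding `Sakamoto2024.kolyvaginSystems_idealOfBasis_eq_fittingIdeal_zmod_three_pow`, R1-22): for a
BASIS `κ` of `KS₁(E[3], 𝓕̄_can, 𝒫(τ))` and a level `d`, with `N_d = H¹_{𝓕̄_can(d)^*}(ℚ, E[3]^∨(1))`
the dual Selmer group for a Poitou–Tate family `inv'` at level `3 = 3^1` (which MAY be taken equal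
to the residual family `inv` — at `m = 1` the two levels coincide): `#N_d ∣ 3 ⟹ ord(κ_d)·#N_d = 3`
and `3 ∣ #N_d ⟹ κ_d = 0`.  Same instantiation and discharges as
`kolyvaginSystems_freeRankOne_propagatedSelmerStructureOne_of_surj` (identity residual pair, (H.1),
(H.3) without tower, Weil, cartesian, unramifiedness, core rank with `hbd`/`hKfin`/`hKSD`).  Binders
(nothing hidden): the fact `hS24₂`, `[Finite E[3]]`, surj(3), the `τ`-datum, `inv` ×4, `hEP`,
an admissible `S` ((Lp) discharged from `hEP`: p04 T-Lp), the Kolyvagin datum on `E[3]`, `inv'` ×4, the basis `κ`, the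
level `d`.  No tower: every surj(3) row incl. EXOTIC.  CONDITIONAL on `hS24₂`; nothing booked.
[cite: Sakamoto2024, Thm. 4.4 (2) (p. 926; = Prop. 7.7, p. 936)] -/
theorem kolyvaginSystems_idealOfBasis_propagatedSelmerStructureOne_of_surj
    (hS24₂ : Sakamoto2024.kolyvaginSystems_idealOfBasis_eq_fittingIdeal_zmod_three_pow)
    [Finite (geomTorsion W ((3 : ℕ) : ℤ))]
    (h3 : W.HasSurjectiveModNGaloisRep ((3 : ℕ) : ℤ))
    (τ : absoluteGaloisGroup ℚ) (hτμ : τ ∈ rootsOfUnityFixer ℚ 3)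
    (hτq : Nonempty (cokerSubOne (W.torsionGaloisModule ((3 : ℕ) : ℤ)) τ ≃+ ZMod 3))
    (inv : LocalInvariants ℚ 3) (hperf : inv.IsPerfect) (hsum : inv.SumLocalTermEqZero)
    (hunro : inv.UnramifiedOrthogonal) (hcompl : inv.SelmerComplement)
    (hEP : ∀ v : HeightOneSpectrum (𝓞 ℚ), localEulerPoincareCharacteristic (v.adicCompletion ℚ))
    (S : Finset (Place ℚ)) (hS : ∀ w : InfinitePlace ℚ, (Sum.inl w : Place ℚ) ∈ S)
    (h3S : ∀ v : HeightOneSpectrum (𝓞 ℚ), ((3 : ℕ) : 𝓞 ℚ) ∈ v.asIdeal → (Sum.inr v : Place ℚ) ∈ S)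
    (hbadS : ∀ v : HeightOneSpectrum (𝓞 ℚ), ¬ W.HasGoodReductionAt v → (Sum.inr v : Place ℚ) ∈ S)
    (D : KolyvaginDatum (W.torsionGaloisModule ((3 : ℕ) : ℤ)))
    (η : (q : HeightOneSpectrum (𝓞 ℚ)) → (ZMod (Ideal.absNorm q.asIdeal))ˣ)
    (hP : D.primes = frobeniusClassPrimes (W.torsionGaloisModule ((3 : ℕ) : ℤ))
      {v | (Sum.inr v : Place ℚ) ∈ S} τ 3)
    (hT : D.transverse = cyclotomicTransverse (W.torsionGaloisModule ((3 : ℕ) : ℤ)))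
    (hD : D.HasCanonicalComparison 3 η)
    (inv' : LocalInvariants ℚ 3) (hperf' : inv'.IsPerfect) (hsum' : inv'.SumLocalTermEqZero)
    (hunro' : inv'.UnramifiedOrthogonal) (hcompl' : inv'.SelmerComplement)
    (κ : D.kolyvaginSystems (propagatedSelmerStructureOne W 3)) (hκ : AddSubgroup.zmultiples κ = ⊤)
    (d : Finset (HeightOneSpectrum (𝓞 ℚ))) (hd : D.IsLevel d) :
    (Nat.card (inv'.dualSelmerStructure (W.torsionGaloisModule ((3 : ℕ) : ℤ))
        (D.atLevel (propagatedSelmerStructureOne W 3) d)).selmerGroup ∣ 3 →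
      addOrderOf (κ.1 d) *
        Nat.card (inv'.dualSelmerStructure (W.torsionGaloisModule ((3 : ℕ) : ℤ))
          (D.atLevel (propagatedSelmerStructureOne W 3) d)).selmerGroup = 3) ∧
    (3 ∣ Nat.card (inv'.dualSelmerStructure (W.torsionGaloisModule ((3 : ℕ) : ℤ))
        (D.atLevel (propagatedSelmerStructureOne W 3) d)).selmerGroup → κ.1 d = 0) := by
  haveI : Fact (Nat.Prime 3) := ⟨Nat.prime_three⟩
  haveI : NeZero ((3 : ℕ) : ℚ) := ⟨by norm_num⟩
  haveI hF : Fact (Nat.Prime (3 ^ 1)) := ⟨by norm_num⟩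
  letI : Module (ZMod (3 ^ 1)) (geomTorsion W ((3 : ℕ) : ℤ)) :=
    (inferInstance : Module (ZMod 3) (geomTorsion W ((3 : ℕ) : ℤ)))
  haveI : Module.Finite (ZMod (3 ^ 1)) (geomTorsion W ((3 : ℕ) : ℤ)) := Module.Finite.of_finite
  obtain ⟨e, hμ, hadd₁, hadd₂, halt, hnondeg, hgal⟩ :=
    exists_weilPairing_holds W 3 (by norm_num) (by norm_num)
  let T : Finset (HeightOneSpectrum (𝓞 ℚ)) := S.preimage Sum.inr Sum.inr_injective.injOn
  have h3T : ∀ v : HeightOneSpectrum (𝓞 ℚ), ((3 : ℕ) : 𝓞 ℚ) ∈ v.asIdeal → v ∈ T :=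
    fun v hv => Finset.mem_preimage.mpr (h3S v hv)
  have hbadT : ∀ v : HeightOneSpectrum (𝓞 ℚ), ¬ W.HasGoodReductionAt v → v ∈ T :=
    fun v hv => Finset.mem_preimage.mpr (hbadS v hv)
  have hKfin : Finite (W.kummerSelmerStructure ((3 : ℕ) : ℤ)).selmerGroup := by
    rw [← selmerGroup_eq_selmerGroup_kummerSelmerStructure]
    exact W.finite_selmerGroup_holds (by norm_num)
  haveI := hKfin
  have hKSD := natCard_selmerGroup_kummer_eq_dual W 3 e hμ hadd₁ hadd₂ hgal halt hnondeg
    Nat.prime_three.isPrimePow (by decide) inv (fun v => (hperf v).1.injective) hEP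
  have hCR : LocalInvariants.HasCoreRank inv (propagatedSelmerStructureOne W 3) 3 1 :=
    hasCoreRank_one_propagatedSelmerStructureOne W inv hperf hsum hcompl T h3T hbadT
      (fun v hv => bounded_pPrimaryTorsion_localGaloisModule_rat W 3 hv) hKfin hKSD
      (fun v hv => natCard_propagatedSelmerStructureOne_three W v (hEP v) hv)
  have hco := isResiduallyCoisotropic_propagatedSelmerStructureOne_three W e hμ hadd₁ hadd₂ hgal
    halt hnondeg inv hperf S (fun v _ => hEP v)
  have h := hS24₂ (geomTorsion W ((3 : ℕ) : ℤ)) (geomTorsion W ((3 : ℕ) : ℤ)) 1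
    (W.torsionGaloisModule _) (W.torsionGaloisModule _) ContIntertwiningMap.id ContIntertwiningMap.id
    τ (weilDualIntertwining W 3 e hμ hadd₁ hadd₂ hgal) inv S (propagatedSelmerStructureOne W 3) D η
    (fun x => ⟨x, rfl⟩) (id_eq_zero_iff_exists W) (id_id_eq_pow_smul W)
    (residual_irreducible_of_surj W 3 h3) (by simpa using hτμ) (by simpa using hτq)
    (fun f hf => hH3_self_of_hasSurjectiveModNGaloisRep W 3 (by decide) h3 f
      (fun u hu hμu => hf u hu (by simpa using hμu)))
    (X11b.LocBridge.weilDualHom_bijective W 3 e hμ hadd₁ hadd₂ hnondeg)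
    hperf hsum hunro hcompl hS (fun v hv => not_mem_and_isUnramifiedAt_three_of_not_mem W S h3S hbadS hv)
    (propagatedSelmerStructureOne_three_isUnramifiedOutside W S hS h3S hbadS)
    (IdPair.isCartesian_id _ S) (by rw [IdPair.induced_id]; exact hCR)
    (by rw [IdPair.induced_id]; exact hco) (by simpa using hP) hT (by simpa using hD)
    inv' hperf' hsum' hunro' hcompl' κ hκ d hd
  simpa using h

end Summit.BirchSwinnertonDyer.Rank1Residual.GaloisImage

end
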